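import Mathlib
import Literature.Analysis.Matrix.LocalFloorWeightedCoercivity
import HarnessLib

/-!
# Agmon decay of sub-threshold eigenvectors of `AᴴA` below a LOCAL floor

Topic `Literature/Analysis/Matrix`; namespace `Literature.Analysis.Matrix`.  Everything here is
PROVED (no definitions, no named facts).  Built on `LocalFloorWeightedCoercivity` (the
Combes–Thomas/Agmon weighted `ℓ²` bound below a local floor); companion of
`LocalFloorDimensionBound` (the rank count below a local floor).

Setting.  `ι` is a finite index set with a symmetric `ℕ`-valued `dist`, `A : Matrix ι ι ℂ` has
RANGE ONE (`A i j ≠ 0 → dist i j ≤ 1`), absolute row and column sums over `{j | dist i j ≠ 0}` at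
most `h`, and the crude size bound `Σ|((AᴴA)w)_i|² ≤ M² Σ|w_i|²`; `ρ : ι → ℕ` is `1`-Lipschitz
(`ρ j ≤ ρ i + dist i j`, typically the distance to a "rough" region); `η := h(e^θ − 1)`.

* `norm_sq_le_of_eigenvector_of_localFloor` — **Agmon decay of sub-threshold eigenvectors**: if
  the LOCAL FLOOR `F Σ|w|² ≤ Σ|Aw|²` holds for vectors supported in `{r ≤ ρ}`,
  `t² − 2ηt − η² − e ≥ γ > 0` for `t ≥ √F` (`θ ≥ 0`), and `(AᴴA)v = e v`, then for every index `k`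
  `|v_k|² ≤ e^{2θ(r+1)}((2M² + 2e²)/γ² + 1) · e^{−2θρ_k} · Σ|v_i|²`:
  an eigenvector strictly below the local floor is exponentially small in the distance `ρ` from
  the region where the floor fails, at any rate `θ` the coercivity margin allows, with constants
  independent of `|ι|`.

Proof (Agmon's method on a lattice, cf. [AizenmanWarzel2015, §10.3]; [CombesThomas1973]): cut the
eigenvector off sharply, `x := 𝟙[r ≤ ρ]·v`.  Since `AᴴA` has range two, `g := (AᴴA − e)x =
(AᴴA − e)(x − v)` is supported in the layer `{ρ ≤ r + 1}` and `Σ|g|² ≤ (2M² + 2e²)Σ|v|²`; the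
weighted `ℓ²` bound `weighted_sum_sq_le_of_localFloor` with weights `e^{θρ}` (bounded by
`e^{θ(r+1)}` on the layer) gives `γ² e^{2θρ_k}|v_k|² ≤ γ² Σ e^{2θρ}|x|² ≤ e^{2θ(r+1)} Σ|g|²` for
`ρ_k ≥ r`, and the indices with `ρ_k < r` are covered by the additive `1`.

References: S. Agmon, *Lectures on exponential decay of solutions of second-order elliptic
equations* (1982); Combes–Thomas, Comm. Math. Phys. 34 (1973) 251 [CombesThomas1973];
Aizenman–Warzel, GSM 168, §10.3 [AizenmanWarzel2015].  Not here: optimal rates, operator-norm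
formulations, infinite index sets.
-/

noncomputable section

open Finset
open scoped Matrix ComplexConjugate

namespace Literature.Analysis.Matrix

section LocalAgmon

variable {ι : Type*} [Fintype ι] [DecidableEq ι]

/-- **Agmon decay of sub-threshold eigenvectors below a local floor.**  Let `dist` be a symmetric
`ℕ`-valued distance on the finite index set `ι`, `A : Matrix ι ι ℂ` of range one with off-site
absolute row and column sums `≤ h`, `Σ|((AᴴA)w)_i|² ≤ M² Σ|w_i|²`, and `ρ : ι → ℕ` with
`ρ j ≤ ρ i + dist i j` (`1`-Lipschitz; typically the distance to a "rough" region).  Suppose the LOCAL FLOOR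
`F Σ|w_i|² ≤ Σ|(Aw)_i|²` for every `w` supported in `{r ≤ ρ}`, a rate `θ ≥ 0` and a margin
`γ > 0` with `t² − 2ηt − η² − e ≥ γ` for all `t ≥ √F` (`η = h(e^θ − 1)`).  Then every
eigenvector `(AᴴA)v = e v` satisfies, for every index `k`,
`|v_k|² ≤ e^{2θ(r+1)} ((2M² + 2e²)/γ² + 1) · e^{−2θρ_k} · Σ_i |v_i|²`.
(Sharp cutoff `x = 𝟙[r ≤ ρ]v`; `(AᴴA − e)x` lives on the layer `ρ ≤ r + 1` because `AᴴA` has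
range two; then `weighted_sum_sq_le_of_localFloor`.)  Lattice version of Agmon's estimate /
the Combes–Thomas method (Aizenman–Warzel §10.3). [folklore] -/
theorem norm_sq_le_of_eigenvector_of_localFloor (dist : ι → ι → ℕ)
    (hds : ∀ i j, dist i j = dist j i) (A : Matrix ι ι ℂ) (hrange : ∀ i j, A i j ≠ 0 → dist i j ≤ 1) (h : ℝ)
    (hrow : ∀ i, ∑ j ∈ univ.filter (fun j => dist i j ≠ 0), ‖A i j‖ ≤ h)
    (hcol : ∀ j, ∑ i ∈ univ.filter (fun i => dist i j ≠ 0), ‖A i j‖ ≤ h)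
    (M : ℝ) (hM : ∀ w : ι → ℂ, ∑ i, ‖((Aᴴ * A) *ᵥ w) i‖ ^ 2 ≤ M ^ 2 * ∑ i, ‖w i‖ ^ 2)
    (ρ : ι → ℕ) (hρ : ∀ i j, ρ j ≤ ρ i + dist i j) (r : ℕ)
    (F e θ γ : ℝ) (hθ : 0 ≤ θ) (hγ : 0 < γ)
    (hfloor : ∀ w : ι → ℂ, (∀ i, w i ≠ 0 → r ≤ ρ i) →
      F * ∑ i, ‖w i‖ ^ 2 ≤ ∑ i, ‖(A *ᵥ w) i‖ ^ 2)
    (hcoer : ∀ t : ℝ, Real.sqrt F ≤ t →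
      γ ≤ t ^ 2 - 2 * (h * (Real.exp θ - 1)) * t - (h * (Real.exp θ - 1)) ^ 2 - e)
    (v : ι → ℂ) (hv : (Aᴴ * A) *ᵥ v = (e : ℂ) • v) (k : ι) :
    ‖v k‖ ^ 2 ≤ Real.exp (θ * (r + 1)) ^ 2 * ((2 * M ^ 2 + 2 * e ^ 2) / γ ^ 2 + 1) *
      Real.exp (-(2 * θ * ρ k)) * ∑ i, ‖v i‖ ^ 2 := by
  -- the cut-off eigenvector and its defect
  set x : ι → ℂ := fun i => if r ≤ ρ i then v i else 0 with hx
  set K : Matrix ι ι ℂ := Aᴴ * A + ((-e : ℝ) : ℂ) • (1 : Matrix ι ι ℂ) with hK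
  set g : ι → ℂ := K *ᵥ x with hg
  set N : ℝ := ∑ i, ‖v i‖ ^ 2 with hN
  have hN0 : 0 ≤ N := Finset.sum_nonneg fun i _ => by positivity
  have hxgood : ∀ i, x i ≠ 0 → r ≤ ρ i := by
    intro i hi
    by_contra hri
    exact hi (by simp [hx, hri])
  -- `K v = 0`
  have hKv : K *ᵥ v = 0 := by
    rw [hK, Matrix.add_mulVec, hv, Matrix.smul_mulVec, Matrix.one_mulVec, ← add_smul]
    push_cast
    simp
  -- (1) `g` lives on the layer `ρ ≤ r + 1` (range two of `AᴴA`)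
  have hentry : ∀ i j, r + 2 ≤ ρ i → ρ j < r → K i j = 0 := by
    intro i j hi hj
    have hij : i ≠ j := by
      rintro rfl
      omega
    rw [hK, Matrix.add_apply, Matrix.smul_apply, Matrix.one_apply_ne hij, smul_zero, add_zero,
      Matrix.mul_apply]
    refine Finset.sum_eq_zero fun l _ => ?_
    rw [Matrix.conjTranspose_apply]
    by_cases hli : A l i = 0
    · simp [hli]
    by_cases hlj : A l j = 0
    · simp [hlj]
    exfalso
    have h1 := hrange l i hli
    have h2 := hrange l j hlj
    have h3 := hρ l i
    have h4 := hρ j l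
    rw [hds j l] at h4
    omega
  have hg0 : ∀ i, r + 2 ≤ ρ i → g i = 0 := by
    intro i hi
    have : g i = (K *ᵥ (x - v)) i := by rw [Matrix.mulVec_sub, hKv, sub_zero]
    rw [this]
    simp only [Matrix.mulVec, dotProduct]
    refine Finset.sum_eq_zero fun j _ => ?_
    by_cases hj : r ≤ ρ j
    · simp [hx, hj]
    · rw [hentry i j hi (not_le.mp hj), zero_mul]
  -- (2) `Σ|g|² ≤ (2M² + 2e²) N`
  have hgN : ∑ i, ‖g i‖ ^ 2 ≤ (2 * M ^ 2 + 2 * e ^ 2) * N := by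
    set w : ι → ℂ := x - v with hw
    have hgw : g = (Aᴴ * A) *ᵥ w + ((-e : ℝ) : ℂ) • w := by
      rw [hg, show K *ᵥ x = K *ᵥ w by rw [hw, Matrix.mulVec_sub, hKv, sub_zero], hK,
        Matrix.add_mulVec, Matrix.smul_mulVec, Matrix.one_mulVec]
    have hwle : ∀ i, ‖w i‖ ≤ ‖v i‖ := by
      intro i
      simp only [hw, hx, Pi.sub_apply]
      split_ifs
      · simp
      · simp
    have hwN : ∑ i, ‖w i‖ ^ 2 ≤ N :=
      Finset.sum_le_sum fun i _ => pow_le_pow_left₀ (norm_nonneg _) (hwle i) 2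
    have hw0 : 0 ≤ ∑ i, ‖w i‖ ^ 2 := Finset.sum_nonneg fun i _ => by positivity
    have hpt : ∀ i, ‖g i‖ ^ 2 ≤ 2 * ‖((Aᴴ * A) *ᵥ w) i‖ ^ 2 + 2 * (e ^ 2 * ‖w i‖ ^ 2) := by
      intro i
      rw [hgw, Pi.add_apply, Pi.smul_apply, smul_eq_mul]
      have h1 := norm_add_le (((Aᴴ * A) *ᵥ w) i) (((-e : ℝ) : ℂ) * w i)
      have h2 : ‖((-e : ℝ) : ℂ) * w i‖ = |e| * ‖w i‖ := by
        rw [norm_mul, Complex.norm_real, Real.norm_eq_abs, abs_neg]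
      rw [h2] at h1
      have h3 : (|e| * ‖w i‖) ^ 2 = e ^ 2 * ‖w i‖ ^ 2 := by rw [mul_pow, sq_abs]
      have h4 : ‖((Aᴴ * A) *ᵥ w) i + ((-e : ℝ) : ℂ) * w i‖ ^ 2 ≤
          (‖((Aᴴ * A) *ᵥ w) i‖ + |e| * ‖w i‖) ^ 2 := pow_le_pow_left₀ (norm_nonneg _) h1 2
      nlinarith [sq_nonneg (‖((Aᴴ * A) *ᵥ w) i‖ - |e| * ‖w i‖)]
    calc ∑ i, ‖g i‖ ^ 2 ≤ ∑ i, (2 * ‖((Aᴴ * A) *ᵥ w) i‖ ^ 2 + 2 * (e ^ 2 * ‖w i‖ ^ 2)) :=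
          Finset.sum_le_sum fun i _ => hpt i
      _ = 2 * ∑ i, ‖((Aᴴ * A) *ᵥ w) i‖ ^ 2 + 2 * (e ^ 2 * ∑ i, ‖w i‖ ^ 2) := by
          rw [Finset.sum_add_distrib, ← Finset.mul_sum, ← Finset.mul_sum, ← Finset.mul_sum]
      _ ≤ 2 * (M ^ 2 * ∑ i, ‖w i‖ ^ 2) + 2 * (e ^ 2 * ∑ i, ‖w i‖ ^ 2) := by
          linarith [hM w]
      _ = (2 * M ^ 2 + 2 * e ^ 2) * ∑ i, ‖w i‖ ^ 2 := by ring
      _ ≤ (2 * M ^ 2 + 2 * e ^ 2) * N := mul_le_mul_of_nonneg_left hwN (by positivity)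
  -- (3) the weighted defect: `G ≤ e^{2θ(r+1)} (2M² + 2e²) N`
  have hG : ∑ i, Real.exp (θ * (ρ i : ℝ)) ^ 2 * ‖g i‖ ^ 2 ≤
      Real.exp (θ * (r + 1)) ^ 2 * ((2 * M ^ 2 + 2 * e ^ 2) * N) := by
    calc ∑ i, Real.exp (θ * (ρ i : ℝ)) ^ 2 * ‖g i‖ ^ 2 ≤
        ∑ i, Real.exp (θ * (r + 1)) ^ 2 * ‖g i‖ ^ 2 := by
          refine Finset.sum_le_sum fun i _ => ?_
          by_cases hgi : g i = 0
          · simp [hgi]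
          · have hri : ρ i ≤ r + 1 := by
              by_contra hlt
              exact hgi (hg0 i (by omega))
            have hri' : (ρ i : ℝ) ≤ r + 1 := by exact_mod_cast hri
            have hexp : Real.exp (θ * (ρ i : ℝ)) ≤ Real.exp (θ * (r + 1)) :=
              Real.exp_le_exp.mpr (mul_le_mul_of_nonneg_left hri' hθ)
            exact mul_le_mul_of_nonneg_right
              (pow_le_pow_left₀ (Real.exp_pos _).le hexp 2) (sq_nonneg _)
      _ = Real.exp (θ * (r + 1)) ^ 2 * ∑ i, ‖g i‖ ^ 2 := by rw [Finset.mul_sum]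
      _ ≤ _ := mul_le_mul_of_nonneg_left hgN (sq_nonneg _)
  -- (4) the weighted `ℓ²` bound for the cut-off eigenvector
  have hρ' : ∀ i j, |(ρ i : ℝ) - ρ j| ≤ dist i j := by
    intro i j
    have h1 : (ρ j : ℝ) ≤ ρ i + dist i j := by exact_mod_cast hρ i j
    have h2 : (ρ i : ℝ) ≤ ρ j + dist i j := by
      have := hρ j i
      rw [hds j i] at this
      exact_mod_cast this
    rw [abs_le]
    constructor <;> linarith
  have hS := weighted_sum_sq_le_of_localFloor dist A hrange h hrow hcol (fun i => (ρ i : ℝ))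
    hρ' (fun i => r ≤ ρ i) F (-e) θ γ hθ hγ.le hfloor
    (fun t ht => by have := hcoer t ht; linarith) x hxgood
  rw [← hg] at hS
  -- `γ² S ≤ G ≤ e^{2θ(r+1)} (2M² + 2e²) N`
  have hSG := hS.trans hG
  -- (5) conclusion
  set C₁ : ℝ := Real.exp (θ * (r + 1)) ^ 2 with hC₁
  have hC₁1 : 1 ≤ C₁ := one_le_pow₀ (Real.one_le_exp (by positivity))
  have hγ2 : 0 < γ ^ 2 := by positivity
  have hE : 0 < Real.exp (2 * θ * ρ k) := Real.exp_pos _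
  have hEeq : Real.exp (θ * (ρ k : ℝ)) ^ 2 = Real.exp (2 * θ * ρ k) := by
    rw [pow_two, ← Real.exp_add]; ring_nf
  have hQ0 : 0 ≤ (2 * M ^ 2 + 2 * e ^ 2) / γ ^ 2 := by positivity
  -- it suffices to bound `|v_k|² e^{2θρ_k}`
  suffices hmain : ‖v k‖ ^ 2 * Real.exp (2 * θ * ρ k) ≤
      C₁ * ((2 * M ^ 2 + 2 * e ^ 2) / γ ^ 2 + 1) * N by
    calc ‖v k‖ ^ 2 = ‖v k‖ ^ 2 * Real.exp (2 * θ * ρ k) * (Real.exp (2 * θ * ρ k))⁻¹ := by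
          field_simp
      _ ≤ C₁ * ((2 * M ^ 2 + 2 * e ^ 2) / γ ^ 2 + 1) * N * (Real.exp (2 * θ * ρ k))⁻¹ :=
          mul_le_mul_of_nonneg_right hmain (inv_nonneg.mpr hE.le)
      _ = _ := by rw [Real.exp_neg]; ring
  by_cases hk : r ≤ ρ k
  · -- inside the smooth region: `e^{2θρ_k}|v_k|² ≤ S ≤ G/γ²`
    have hxk : x k = v k := by simp [hx, hk]
    have h1 : Real.exp (θ * (ρ k : ℝ)) ^ 2 * ‖x k‖ ^ 2 ≤
        ∑ i, Real.exp (θ * (ρ i : ℝ)) ^ 2 * ‖x i‖ ^ 2 :=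
      Finset.single_le_sum (f := fun i => Real.exp (θ * (ρ i : ℝ)) ^ 2 * ‖x i‖ ^ 2)
        (fun i _ => by positivity) (Finset.mem_univ k)
    rw [hxk, hEeq] at h1
    have h2 : γ ^ 2 * (‖v k‖ ^ 2 * Real.exp (2 * θ * ρ k)) ≤ C₁ * ((2 * M ^ 2 + 2 * e ^ 2) * N) :=
      by nlinarith
    have h3 : ‖v k‖ ^ 2 * Real.exp (2 * θ * ρ k) ≤ C₁ * ((2 * M ^ 2 + 2 * e ^ 2) / γ ^ 2) * N := by
      rw [show C₁ * ((2 * M ^ 2 + 2 * e ^ 2) / γ ^ 2) * N =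
        C₁ * ((2 * M ^ 2 + 2 * e ^ 2) * N) / γ ^ 2 by ring, le_div_iff₀ hγ2]
      linarith
    calc ‖v k‖ ^ 2 * Real.exp (2 * θ * ρ k) ≤ C₁ * ((2 * M ^ 2 + 2 * e ^ 2) / γ ^ 2) * N := h3
      _ ≤ C₁ * ((2 * M ^ 2 + 2 * e ^ 2) / γ ^ 2 + 1) * N := by
          refine mul_le_mul_of_nonneg_right ?_ hN0
          nlinarith
  · -- inside the collar: `|v_k|² ≤ N` and `e^{2θρ_k} ≤ e^{2θ(r+1)}`
    have hk' : (ρ k : ℝ) ≤ r + 1 := by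
      have : ρ k ≤ r + 1 := by omega
      exact_mod_cast this
    have h1 : Real.exp (2 * θ * ρ k) ≤ C₁ := by
      rw [← hEeq]
      exact pow_le_pow_left₀ (Real.exp_pos _).le
        (Real.exp_le_exp.mpr (mul_le_mul_of_nonneg_left hk' hθ)) 2
    have h2 : ‖v k‖ ^ 2 ≤ N :=
      Finset.single_le_sum (f := fun i => ‖v i‖ ^ 2) (fun i _ => by positivity) (Finset.mem_univ k)
    calc ‖v k‖ ^ 2 * Real.exp (2 * θ * ρ k) ≤ N * C₁ :=
          mul_le_mul h2 h1 hE.le hN0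
      _ = C₁ * 1 * N := by ring
      _ ≤ C₁ * ((2 * M ^ 2 + 2 * e ^ 2) / γ ^ 2 + 1) * N := by
          refine mul_le_mul_of_nonneg_right ?_ hN0
          refine mul_le_mul_of_nonneg_left ?_ (by linarith)
          linarith

end LocalAgmon

end Literature.Analysis.Matrix
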